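import Literature.Computability.Complexity.RothvossUBadPart
import Literature.Computability.Complexity.RothvossMBadPart
import HarnessLib
import Literature.InformationTheory.Entropy.FewBiasedCoordinates

/-!
# Lemma 9, Lemma 7 and Theorem 1 of Rothvoss 2017

This file has two parts: **Part I** (this docstring) — Lemma 9 and the contribution of good pairs
(§3.4); **Part II** — the assembly of Lemma 7 from its good / small / `U`-bad / `M`-bad parts and
the proof `Rothvoss.matching_slack_bound_holds : rothvoss_matching_slack_bound` of the named fact (Theorem 1, slack form).

# Part I — Lemma 9 and the contribution of good pairs (§3.4)

Continuation of `RothvossMeasures.lean` (Part III, re-sampling). For a fixed encoding `τ` (partition `T` and `k`-matching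
`F = τ F₀`), the `3`-matchings `H ⊆ F` are the encodings `τ_π = alphaEquiv π ⬝ τ`,
`π ∈ Perm (P k)`, with `H_π` indexed by `S π = π(Fin 3) ⊆ P k`. We PROVE, for a rectangle
`𝓡 = 𝓤 × 𝓜` of cuts and perfect matchings without an entry `|M ∩ δ(U)| = 1` (`μ₁(𝓡) = 0`):

* `two_le_card_inter_of_Good` — the heart of **Lemma 9**: if `(T, H_π)` and `(T, H_{π'})` are both
  good then `|S π ∩ S π'| ≥ 2` (otherwise two `C`-endpoints `u, v` of `H_π ∖ H_{π'}`, the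
  `k`-matching `F* = H_{π'} ∪ {(u,v)} ∪ …` = `gSwap`, an `M ∈ 𝓜` through `(u, v)` from
  `M`-goodness of `(T, H_{π'})` and a cut `U ∈ 𝓤` with `U ∩ C = V(H_π) ∩ C` from `U`-goodness of
  `(T, H_π)` give `|δ(U) ∩ M| = 1`);
* `card_good_le` — **Lemma 9**: `#{π : (T, H_π) good} ≤ 36 · k!/(k² - k)` (the paper's
  `Pr_{H ∼ binom(F,3)}[GOOD] ≤ 3k / binom(k,3) ≤ 100/k²`; here via ordered pairs: a uniformly random
  `π` sends two given indices to a given ordered pair of distinct values with probability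
  `1/(k² - k)`, `card_filter_pair_eq`);
* `sum_good_le` — **§3.4**: `∑_τ GOOD · p^ex_U p^ex_M ≤ (1+ε)³ · 36/(k²-k) · ∑_τ p_U(F) p_M(F)`, i.e.
  `E_T E_H[GOOD · p^ex_M p^ex_U] ≤ (1+ε)³ (36/(k²-k)) · μ_k(𝓡)`.

## References

* T. Rothvoss, *The matching polytope has exponential extension complexity*, J. ACM 64(6) (2017)
  41:1–41:19, Lemma 9 and §3.4 [Rothvoss2017].
-/

namespace Literature.Computability.Complexity

open Finset
open Literature.Probability.LatticeModels

namespace Rothvoss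

open scoped Classical

variable {k m : ℕ}

/-- The index set `S π = π(Fin 3)` of the `3`-matching `H_π ⊆ F`. [cite: Rothvoss2017, §3.4] -/
def S3 (π : Equiv.Perm (P k)) : Finset (P k) := univ.image fun j : Fin 3 => π (Sum.inl j)

/-- Membership in `S π`. [folklore] -/
theorem mem_S3 {π : Equiv.Perm (P k)} {p : P k} : p ∈ S3 π ↔ ∃ j : Fin 3, π (Sum.inl j) = p := by
  simp [S3]

/-- An index outside `S π'` is sent by `π'⁻¹` to an `inr`. [folklore] -/
theorem exists_inr_of_notMem_S3 {π' : Equiv.Perm (P k)} {p : P k} (hp : p ∉ S3 π') :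
    ∃ x, π'⁻¹ p = Sum.inr x := by
  rcases h : π'⁻¹ p with j | x
  · exact absurd (mem_S3.2 ⟨j, by rw [← h]; simp⟩) hp
  · exact ⟨x, rfl⟩

/-! ### Elementary facts about `ext₀`-matchings and the cut `τ_π(cut₀ I)` -/

/-- An `ext₀`-matching maps `Aᵢ` to itself. [cite: Rothvoss2017, §3.2] -/
theorem ext₀_a {f : TV k m → TV k m} (hf : f ∈ ext₀ k m) (i : Fin m) (y : Fin (k - 3)) :
    ∃ y', f (.a i y) = .a i y' :=
  lab_eq_A_iff.1 ((mem_ext₀.1 hf).2.2.1 (.a i y) (by simp [lab, Lab.isSmall]))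

/-- An `ext₀`-matching maps `C`-endpoints into the core `C ∪ D`. [cite: Rothvoss2017, §3.2] -/
theorem ext₀_cVert {f : TV k m → TV k m} (hf : f ∈ ext₀ k m) (q : P k) :
    (∃ r, f (cVert q) = cVert r) ∨ ∃ r, f (cVert q) = dVert r := by
  obtain ⟨-, hH, -, hc⟩ := mem_ext₀.1 hf
  rcases q with j | x
  · exact Or.inr ⟨.inl j, hH j⟩
  · have h := hc (.cr x) (by simp [lab, Lab.isCoreRem])
    show (∃ r, f (TV.cr x) = cVert r) ∨ ∃ r, f (TV.cr x) = dVert r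
    generalize f (TV.cr x) = w at h ⊢
    cases w with
    | cr y => exact Or.inl ⟨.inr y, rfl⟩
    | dr y => exact Or.inr ⟨.inr y, rfl⟩
    | _ => simp [lab, Lab.isCoreRem] at h

/-- A `C`-endpoint lies in a `Q₃`-template cut iff it is an `H₀`-endpoint. [folklore] -/
theorem cutMem_cVert_iff (I : Finset (Fin m)) (q : P k) :
    cutMem I (cVert q : TV k m) = true ↔ ∃ j, q = Sum.inl j := by
  rcases q with j | x <;> simp [cVert, cutMem]

/-- `D`-endpoints lie in no `Q₃`-template cut. [folklore] -/
@[simp] theorem cutMem_dVert (I : Finset (Fin m)) (q : P k) : cutMem I (dVert q : TV k m) = false := by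
  rcases q with j | x <;> rfl

/-- The cut of the re-sampled encoding on the template: `alpha π (cut₀ I) = ⋃_{i ∈ I} Aᵢ ∪ cVert(S π)`.
[cite: Rothvoss2017, §3.4] -/
theorem mem_cut₀_map_alpha {π : Equiv.Perm (P k)} {I : Finset (Fin m)} {v : TV k m} :
    v ∈ (cut₀ I).map (alphaEquiv π).toEmbedding ↔
      (∃ i ∈ I, ∃ y, v = .a i y) ∨ ∃ p ∈ S3 π, v = cVert p := by
  rw [mem_map_equiv, mem_cut₀, alphaEquiv_symm_apply]
  rcases TV.trichotomy v with ⟨i, x, rfl⟩ | ⟨i, x, rfl⟩ | ⟨p, rfl⟩ | ⟨p, rfl⟩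
  · rw [alpha_a]
    constructor
    · intro h
      exact Or.inl ⟨i, by simpa [cutMem] using h, x, rfl⟩
    · rintro (⟨i', hi', y, h⟩ | ⟨p, -, h⟩)
      · cases h
        simpa [cutMem] using hi'
      · rcases p with j | y <;> simp [cVert] at h
  · rw [alpha_b]
    constructor
    · intro h
      simp [cutMem] at h
    · rintro (⟨i', -, y, h⟩ | ⟨p, -, h⟩)
      · cases h
      · rcases p with j | y <;> simp [cVert] at h
  · rw [alpha_cVert, cutMem_cVert_iff]
    constructor
    · rintro ⟨j, hj⟩
      right
      refine ⟨p, mem_S3.2 ⟨j, ?_⟩, rfl⟩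
      rw [← hj]
      simp
    · rintro (⟨i, -, y, h⟩ | ⟨p', hp', h⟩)
      · rcases p with j | x <;> simp [cVert] at h
      · have hpp' : p = p' := cVert_injective h
        subst hpp'
        obtain ⟨j, hj⟩ := mem_S3.1 hp'
        exact ⟨j, by rw [← hj]; simp⟩
  · rw [alpha_dVert, cutMem_dVert]
    simp only [Bool.false_eq_true, false_iff, not_or]
    constructor
    · rintro ⟨i, -, y, h⟩
      rcases p with j | x <;> simp [dVert] at h
    · rintro ⟨p', -, h⟩
      exact cVert_ne_dVert p' p h.symm

/-! ### Lemma 9: two good `3`-matchings inside `F` share two edges -/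

section Lemma9

variable {𝓤 : Finset (Finset (Fin (rvN k m)))}
  {𝓜 : Finset ((⊤ : SimpleGraph (Fin (rvN k m))).Subgraph)} {ε : ℝ}

/-- A positive filtered fraction has a witness. [folklore] -/
theorem exists_of_div_pos {α : Type*} {s : Finset α} {Q : α → Prop} [DecidablePred Q]
    (h : 0 < ((s.filter Q).card : ℝ) / s.card) : ∃ a ∈ s, Q a := by
  have h' : (s.filter Q).Nonempty := by
    rw [← card_pos]
    by_contra h0
    push Not at h0
    have : (s.filter Q).card = 0 := by omega
    rw [this] at h
    simp at h
  obtain ⟨a, ha⟩ := h'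
  exact ⟨a, (mem_filter.1 ha).1, (mem_filter.1 ha).2⟩

/-- **The heart of Lemma 9 (Rothvoss 2017).** In a rectangle without `Q₁`-entries, if the pairs
`(T, H_π)` and `(T, H_{π'})` (same partition, same `k`-matching `F`) are both good, then
`|S π ∩ S π'| ≥ 2`, i.e. `|H_π ∩ H_{π'}| ≥ 2`. [cite: Rothvoss2017, Lem. 9] -/
theorem two_le_card_inter_of_Good (hε : 0 ≤ ε)
    (hR : ∀ U ∈ 𝓤, ∀ M ∈ 𝓜, crossing U M ≠ 1) (τ : Bij k m) {π π' : Equiv.Perm (P k)}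
    (hπ : Good k m 𝓤 𝓜 ε ((alphaEquiv π).trans τ))
    (hπ' : Good k m 𝓤 𝓜 ε ((alphaEquiv π').trans τ)) : 2 ≤ (S3 π ∩ S3 π').card := by
  by_contra hlt
  push Not at hlt
  -- Step 1: two indices `a ≠ b` of `H_π` outside `S π'`
  have hcard : ((univ : Finset (Fin 3)).filter fun j => π (Sum.inl j) ∈ S3 π').card ≤ 1 := by
    have hinj : Function.Injective fun j : Fin 3 => π (Sum.inl j) := fun a b h => by
      simpa using π.injective h
    calc ((univ : Finset (Fin 3)).filter fun j => π (Sum.inl j) ∈ S3 π').card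
        = (((univ : Finset (Fin 3)).filter fun j => π (Sum.inl j) ∈ S3 π').image
            fun j => π (Sum.inl j)).card := (card_image_of_injective _ hinj).symm
      _ ≤ (S3 π ∩ S3 π').card := by
          refine card_le_card fun p hp => ?_
          obtain ⟨j, hj, rfl⟩ := mem_image.1 hp
          exact mem_inter.2 ⟨mem_S3.2 ⟨j, rfl⟩, (mem_filter.1 hj).2⟩
      _ ≤ 1 := by omega
  have hout : 1 < ((univ : Finset (Fin 3)).filter fun j => π (Sum.inl j) ∉ S3 π').card := by
    have h := card_filter_add_card_filter_not (s := (univ : Finset (Fin 3)))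
      (fun j => π (Sum.inl j) ∈ S3 π')
    simp only [card_univ, Fintype.card_fin] at h
    omega
  obtain ⟨a, ha, b, hb, hab⟩ := one_lt_card.1 hout
  have ha' : π (Sum.inl a) ∉ S3 π' := (mem_filter.1 ha).2
  have hb' : π (Sum.inl b) ∉ S3 π' := (mem_filter.1 hb).2
  -- Step 2: their positions `cr x₁`, `cr x₂` in the template of `τ_{π'}`
  obtain ⟨x₁, hx₁⟩ := exists_inr_of_notMem_S3 ha'
  obtain ⟨x₂, hx₂⟩ := exists_inr_of_notMem_S3 hb'
  have hx : x₁ ≠ x₂ := by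
    intro h
    subst h
    have : π (Sum.inl a) = π (Sum.inl b) := π'⁻¹.injective (hx₁.trans hx₂.symm)
    exact hab (by simpa using π.injective this)
  -- Step 3: a matching `M ∈ 𝓜` through `(u, v)` from `M`-goodness of `(T, H_{π'})`
  set g : TV k m → TV k m := gSwap x₁ x₂ with hg
  obtain ⟨hMg, -⟩ := hπ'
  have hpos : 0 < pAll k m 𝓜 ((alphaEquiv π').trans τ) g := by
    have h1 := hMg.1
    have h2 := (hMg.2 g (gSwap_mem hx)).1
    have : 0 < pH k m 𝓜 ((alphaEquiv π').trans τ) / (1 + ε) := div_pos h1 (by linarith)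
    linarith
  obtain ⟨f, hf, hfM⟩ := exists_of_div_pos (by unfold pAll at hpos; exact hpos)
  obtain ⟨hfe, hfg⟩ := mem_matsAll₀.1 hf
  have hfp := (mem_ext₀.1 hfe).1
  -- Step 4: a cut `U ∈ 𝓤` through `V(H_π) ∩ C` from `U`-goodness of `(T, H_π)`
  obtain ⟨-, hUg⟩ := hπ
  obtain ⟨U₀, hU₀, hU₀U⟩ := exists_of_div_pos (by have h := hUg.1; unfold pU at h; exact h)
  obtain ⟨I, -, rfl⟩ := mem_image.1 hU₀
  -- Step 5: `|δ(U) ∩ M| = 1`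
  refine hR _ hU₀U _ hfM ?_
  set W₀ : Finset (TV k m) := (cut₀ I).map (alphaEquiv π).toEmbedding with hW₀
  set f' : TV k m → TV k m := conj (alphaEquiv π') f with hf'
  have hf'p : ∀ v, f' v ≠ v ∧ f' (f' v) = v := conj_spec _ hfp
  rw [Equiv.trans_toEmbedding, ← map_map, toSub_trans _ _ hfp, crossing_xport τ hf'p]
  -- the values of `f'` on the three `C`-endpoints of `H_π`
  set p₁ : P k := π (Sum.inl a) with hp₁
  set p₂ : P k := π (Sum.inl b) with hp₂
  have hp₁₂ : p₁ ≠ p₂ := fun h => hab (by simpa [hp₁, hp₂] using π.injective h)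
  have hf'1 : f' (cVert p₁) = cVert p₂ := by
    show alpha π' (f (alpha π'⁻¹ (cVert p₁))) = cVert p₂
    rw [alpha_cVert, hx₁, show (cVert (Sum.inr x₁) : TV k m) = .cr x₁ from rfl,
      hfg _ (by simp [lab, Lab.isCoreRem]), hg, gSwap_cr_left,
      show (TV.cr x₂ : TV k m) = cVert (Sum.inr x₂) from rfl, alpha_cVert, ← hx₂]
    simp
  have hf'2 : f' (cVert p₂) = cVert p₁ := by
    rw [← hf'1, (hf'p _).2]
  -- membership of core vertices in `W₀`
  have hWc : ∀ s : P k, (cVert s : TV k m) ∈ W₀ ↔ s ∈ S3 π := by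
    intro s
    rw [hW₀, mem_cut₀_map_alpha]
    constructor
    · rintro (⟨i, -, y, h⟩ | ⟨p, hp, h⟩)
      · rcases s with j | x <;> simp [cVert] at h
      · rwa [cVert_injective h]
    · intro h
      exact Or.inr ⟨s, h, rfl⟩
  have hWd : ∀ s : P k, (dVert s : TV k m) ∉ W₀ := by
    intro s h
    rw [hW₀, mem_cut₀_map_alpha] at h
    rcases h with ⟨i, -, y, h⟩ | ⟨p, -, h⟩
    · rcases s with j | x <;> simp [dVert] at h
    · exact cVert_ne_dVert p s h.symm
  have hp₁S : p₁ ∈ S3 π := mem_S3.2 ⟨a, rfl⟩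
  have hp₂S : p₂ ∈ S3 π := mem_S3.2 ⟨b, rfl⟩
  -- `f'` of a `C`-endpoint is a core vertex
  have hcore : ∀ q : P k, (∃ r, f' (cVert q) = cVert r) ∨ ∃ r, f' (cVert q) = dVert r := by
    intro q
    show (∃ r, alpha π' (f (alpha π'⁻¹ (cVert q))) = cVert r) ∨
      ∃ r, alpha π' (f (alpha π'⁻¹ (cVert q))) = dVert r
    rw [alpha_cVert]
    rcases ext₀_cVert hfe (π'⁻¹ q) with ⟨r, hr⟩ | ⟨r, hr⟩
    · exact Or.inl ⟨π' r, by rw [hr, alpha_cVert]⟩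
    · exact Or.inr ⟨π' r, by rw [hr, alpha_dVert]⟩
  -- the crossing set is `{cVert p₃}` for the third index; we show it has exactly one element
  -- (a) every crossing vertex is `cVert s` with `s ∈ S π`, `s ≠ p₁, p₂`
  have hsub : ∀ v ∈ W₀.filter (fun x => f' x ∉ W₀), ∃ s ∈ S3 π, s ≠ p₁ ∧ s ≠ p₂ ∧ v = cVert s := by
    intro v hv
    obtain ⟨hvW, hvf⟩ := mem_filter.1 hv
    rw [hW₀, mem_cut₀_map_alpha] at hvW
    rcases hvW with ⟨i, hi, y, rfl⟩ | ⟨s, hs, rfl⟩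
    · exfalso
      apply hvf
      obtain ⟨y', hy'⟩ := ext₀_a hfe i y
      have : f' (.a i y) = .a i y' := by
        show alpha π' (f (alpha π'⁻¹ (.a i y))) = .a i y'
        rw [alpha_a, hy', alpha_a]
      rw [this, hW₀, mem_cut₀_map_alpha]
      exact Or.inl ⟨i, hi, y', rfl⟩
    · refine ⟨s, hs, ?_, ?_, rfl⟩
      · rintro rfl
        exact hvf (by rw [hf'1]; exact (hWc p₂).2 hp₂S)
      · rintro rfl
        exact hvf (by rw [hf'2]; exact (hWc p₁).2 hp₁S)
  -- (b) the indices `s ∈ S π ∖ {p₁, p₂}` form a set of size `1`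
  have hthird : ((S3 π).filter fun s => s ≠ p₁ ∧ s ≠ p₂).card = 1 := by
    have h3 : (S3 π).card = 3 := by
      rw [S3, card_image_of_injective _ (fun a b h => by simpa using π.injective h)]
      simp
    have h2 : ((S3 π).filter fun s => ¬ (s ≠ p₁ ∧ s ≠ p₂)).card = 2 := by
      have : ((S3 π).filter fun s => ¬ (s ≠ p₁ ∧ s ≠ p₂)) = {p₁, p₂} := by
        ext s
        simp only [mem_filter, not_and_or, not_not, mem_insert, mem_singleton]
        constructor
        · rintro ⟨-, h | h⟩ <;> simp [h]
        · rintro (rfl | rfl)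
          · exact ⟨hp₁S, Or.inl rfl⟩
          · exact ⟨hp₂S, Or.inr rfl⟩
      rw [this, card_pair hp₁₂]
    have h := card_filter_add_card_filter_not (s := S3 π) (fun s => s ≠ p₁ ∧ s ≠ p₂)
    omega
  obtain ⟨p₃, hp₃eq⟩ := card_eq_one.1 hthird
  have hp₃ : p₃ ∈ S3 π ∧ p₃ ≠ p₁ ∧ p₃ ≠ p₂ := by
    have := mem_filter.1 (hp₃eq ▸ mem_singleton_self p₃)
    exact ⟨this.1, this.2⟩
  -- (c) `cVert p₃` does cross
  have hcross : (cVert p₃ : TV k m) ∈ W₀.filter (fun x => f' x ∉ W₀) := by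
    refine mem_filter.2 ⟨(hWc p₃).2 hp₃.1, fun hmem => ?_⟩
    rcases hcore p₃ with ⟨r, hr⟩ | ⟨r, hr⟩
    · rw [hr] at hmem
      have hrS : r ∈ S3 π := (hWc r).1 hmem
      -- `r ∈ S π = {p₁, p₂, p₃}`: each case contradicts the values of the involution `f'`
      by_cases hr1 : r = p₁
      · subst hr1
        have := (hf'p (cVert p₃)).2
        rw [hr, hf'1] at this
        exact hp₃.2.2 (cVert_injective this).symm
      by_cases hr2 : r = p₂
      · subst hr2
        have := (hf'p (cVert p₃)).2
        rw [hr, hf'2] at this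
        exact hp₃.2.1 (cVert_injective this).symm
      · have hr3 : r ∈ (S3 π).filter fun s => s ≠ p₁ ∧ s ≠ p₂ := mem_filter.2 ⟨hrS, hr1, hr2⟩
        rw [hp₃eq, mem_singleton] at hr3
        subst hr3
        exact (hf'p (cVert r)).1 hr
    · exact hWd r (hr ▸ hmem)
  -- conclusion: the crossing set is `{cVert p₃}`
  have hset : W₀.filter (fun x => f' x ∉ W₀) = {cVert p₃} := by
    refine eq_singleton_iff_unique_mem.2 ⟨hcross, fun v hv => ?_⟩
    obtain ⟨s, hs, hs1, hs2, rfl⟩ := hsub v hv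
    have : s ∈ (S3 π).filter fun s => s ≠ p₁ ∧ s ≠ p₂ := mem_filter.2 ⟨hs, hs1, hs2⟩
    rw [hp₃eq, mem_singleton] at this
    rw [this]
  rw [hset, card_singleton]

end Lemma9

/-! ### Counting: permutations sending two indices into a `3`-set -/

/-- For distinct `u, v` and ordered pairs `e, e'` of distinct values, the permutations with
`(π u, π v) = e` and those with `(π u, π v) = e'` are equinumerous (compose with a permutation taking
`e` to `e'`). [folklore] -/
theorem card_filter_pair_eq (u v : P k) {e e' : P k × P k} (he : e.1 ≠ e.2) (he' : e'.1 ≠ e'.2) :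
    ((univ : Finset (Equiv.Perm (P k))).filter fun π => (π u, π v) = e).card =
      ((univ : Finset (Equiv.Perm (P k))).filter fun π => (π u, π v) = e').card := by
  -- `σ` with `σ e.1 = e'.1`, `σ e.2 = e'.2`
  set d₁ : P k := Equiv.swap e.1 e'.1 e.2 with hd₁
  set σ : Equiv.Perm (P k) := Equiv.swap d₁ e'.2 * Equiv.swap e.1 e'.1 with hσ
  have hd₁ne : d₁ ≠ e'.1 := by
    intro h
    have : Equiv.swap e.1 e'.1 e.2 = Equiv.swap e.1 e'.1 e.1 := by
      rw [Equiv.swap_apply_left]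
      exact h
    exact he ((Equiv.injective _ this).symm)
  have hσ1 : σ e.1 = e'.1 := by
    simp only [hσ, Equiv.Perm.mul_apply, Equiv.swap_apply_left]
    exact Equiv.swap_apply_of_ne_of_ne hd₁ne.symm he'
  have hσ2 : σ e.2 = e'.2 := by
    simp only [hσ, Equiv.Perm.mul_apply]
    rw [← hd₁, Equiv.swap_apply_left]
  refine card_bij' (fun π _ => σ * π) (fun π _ => σ⁻¹ * π) (fun π hπ => ?_) (fun π hπ => ?_)
    (fun π _ => by group) (fun π _ => by group)
  · have h := (mem_filter.1 hπ).2
    refine mem_filter.2 ⟨mem_univ _, ?_⟩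
    simp only [Equiv.Perm.mul_apply, Prod.ext_iff] at h ⊢
    rw [h.1, h.2, hσ1, hσ2]
    exact ⟨rfl, rfl⟩
  · have h := (mem_filter.1 hπ).2
    refine mem_filter.2 ⟨mem_univ _, ?_⟩
    simp only [Equiv.Perm.mul_apply, Prod.ext_iff] at h ⊢
    rw [h.1, h.2, ← hσ1, ← hσ2]
    simp

/-- The number `N` of permutations with prescribed distinct values at two distinct indices satisfies
`N · (k² - k) = k!`… in the form needed: `#{π : π u ∈ S, π v ∈ S} · |offDiag P| = |S.offDiag| · |Perm P|`
for `u ≠ v`. [folklore] -/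
theorem card_filter_mem_mem_mul (u v : P k) (huv : u ≠ v) (S : Finset (P k)) :
    ((univ : Finset (Equiv.Perm (P k))).filter fun π => π u ∈ S ∧ π v ∈ S).card *
        (univ : Finset (P k)).offDiag.card =
      S.offDiag.card * (univ : Finset (Equiv.Perm (P k))).card := by
  rcases (univ : Finset (P k)).offDiag.eq_empty_or_nonempty with h0 | ⟨e₀, he₀⟩
  · -- no distinct pairs: `P k` has at most one element, contradicting `u ≠ v`
    exfalso
    have : (u, v) ∈ (univ : Finset (P k)).offDiag := mem_offDiag.2 ⟨mem_univ _, mem_univ _, huv⟩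
    rw [h0] at this
    simp at this
  have he₀' := (mem_offDiag.1 he₀).2.2
  set N := ((univ : Finset (Equiv.Perm (P k))).filter fun π => (π u, π v) = e₀).card with hN
  have hfib : ∀ e ∈ (univ : Finset (P k)).offDiag,
      ((univ : Finset (Equiv.Perm (P k))).filter fun π => (π u, π v) = e).card = N :=
    fun e he => card_filter_pair_eq u v (mem_offDiag.1 he).2.2 he₀'
  -- all permutations, fibred over `offDiag univ`
  have htot : (univ : Finset (Equiv.Perm (P k))).card = (univ : Finset (P k)).offDiag.card * N := by
    rw [card_eq_sum_card_fiberwise (f := fun π : Equiv.Perm (P k) => (π u, π v))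
      (t := (univ : Finset (P k)).offDiag) (fun π _ => by
        simp only [mem_coe, mem_offDiag, mem_univ, true_and]
        exact fun h => huv (π.injective h))]
    rw [sum_congr rfl hfib, sum_const, smul_eq_mul]
  -- permutations landing in `S × S`, fibred over `S.offDiag`
  have hS : ((univ : Finset (Equiv.Perm (P k))).filter fun π => π u ∈ S ∧ π v ∈ S).card =
      S.offDiag.card * N := by
    rw [card_eq_sum_card_fiberwise (f := fun π : Equiv.Perm (P k) => (π u, π v))
      (t := S.offDiag) (fun π hπ => by
        have h := (mem_filter.1 (mem_coe.1 hπ)).2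
        simp only [mem_coe, mem_offDiag]
        exact ⟨h.1, h.2, fun h' => huv (π.injective h')⟩)]
    have : ∀ e ∈ S.offDiag, (((univ : Finset (Equiv.Perm (P k))).filter fun π =>
        π u ∈ S ∧ π v ∈ S).filter fun π => (π u, π v) = e).card = N := by
      intro e he
      obtain ⟨he1, he2, hne⟩ := mem_offDiag.1 he
      rw [filter_filter, ← hfib e (mem_offDiag.2 ⟨mem_univ _, mem_univ _, hne⟩)]
      congr 1
      refine filter_congr fun π _ => ⟨fun h => h.2, fun h => ⟨?_, h⟩⟩
      simp only [Prod.ext_iff] at h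
      exact ⟨h.1 ▸ he1, h.2 ▸ he2⟩
    rw [sum_congr rfl this, sum_const, smul_eq_mul]
  rw [hS, htot]
  ring

/-- **Lemma 9 of Rothvoss 2017 (counting form).** For a fixed partition and `k`-matching, the
number of `3`-matchings `H_π ⊆ F` (counted through `π ∈ Perm (P k)`) with `(T, H_π)` good is at
most `36/(k² - k)` of all: `#{π : GOOD} · (k² - k) ≤ 36 · k!`. [cite: Rothvoss2017, Lem. 9] -/
theorem card_good_le {𝓤 : Finset (Finset (Fin (rvN k m)))}
    {𝓜 : Finset ((⊤ : SimpleGraph (Fin (rvN k m))).Subgraph)} {ε : ℝ} (hε : 0 ≤ ε)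
    (hR : ∀ U ∈ 𝓤, ∀ M ∈ 𝓜, crossing U M ≠ 1) (τ : Bij k m) :
    (((univ : Finset (Equiv.Perm (P k))).filter fun π =>
        Good k m 𝓤 𝓜 ε ((alphaEquiv π).trans τ)).card : ℝ) * (univ : Finset (P k)).offDiag.card ≤
      36 * (univ : Finset (Equiv.Perm (P k))).card := by
  set G := (univ : Finset (Equiv.Perm (P k))).filter fun π =>
    Good k m 𝓤 𝓜 ε ((alphaEquiv π).trans τ) with hG
  rcases G.eq_empty_or_nonempty with h0 | ⟨π₀, hπ₀⟩
  · rw [h0]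
    simp
  have hgood₀ := (mem_filter.1 hπ₀).2
  -- every good `π` sends two distinct `inl`-indices into `S π₀`
  have hcover : G ⊆ ((univ : Finset (Fin 3)).offDiag).biUnion fun ab =>
      (univ : Finset (Equiv.Perm (P k))).filter fun π =>
        π (Sum.inl ab.1) ∈ S3 π₀ ∧ π (Sum.inl ab.2) ∈ S3 π₀ := by
    intro π hπ
    have h2 := two_le_card_inter_of_Good hε hR τ (mem_filter.1 hπ).2 hgood₀
    obtain ⟨p, hp, q, hq, hpq⟩ := one_lt_card.1 (by omega : 1 < (S3 π ∩ S3 π₀).card)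
    obtain ⟨hpS, hp₀⟩ := mem_inter.1 hp
    obtain ⟨hqS, hq₀⟩ := mem_inter.1 hq
    obtain ⟨a, rfl⟩ := mem_S3.1 hpS
    obtain ⟨b, rfl⟩ := mem_S3.1 hqS
    have hab : a ≠ b := fun h => hpq (by rw [h])
    exact mem_biUnion.2 ⟨(a, b), mem_offDiag.2 ⟨mem_univ _, mem_univ _, hab⟩,
      mem_filter.2 ⟨mem_univ _, hp₀, hq₀⟩⟩
  have hS3card : (S3 π₀).offDiag.card = 6 := by
    rw [offDiag_card, S3, card_image_of_injective _ (fun a b h => by simpa using π₀.injective h)]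
    simp
  have hDpos : 0 < (univ : Finset (P k)).offDiag.card := by
    refine card_pos.2 ⟨(π₀ (Sum.inl 0), π₀ (Sum.inl 1)), mem_offDiag.2 ⟨mem_univ _, mem_univ _, ?_⟩⟩
    intro h
    have := π₀.injective h
    simp at this
  -- each of the `6` pieces has `#piece · |offDiag P| = 6 · |Perm|`
  have hpiece : ∀ ab ∈ (univ : Finset (Fin 3)).offDiag,
      (((univ : Finset (Equiv.Perm (P k))).filter fun π =>
        π (Sum.inl ab.1) ∈ S3 π₀ ∧ π (Sum.inl ab.2) ∈ S3 π₀).card : ℝ) *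
          (univ : Finset (P k)).offDiag.card = 6 * (univ : Finset (Equiv.Perm (P k))).card := by
    intro ab hab
    have hne : (Sum.inl ab.1 : P k) ≠ Sum.inl ab.2 := by
      simpa using (mem_offDiag.1 hab).2.2
    have h := card_filter_mem_mem_mul (Sum.inl ab.1) (Sum.inl ab.2) hne (S3 π₀)
    rw [hS3card] at h
    exact_mod_cast h
  calc (G.card : ℝ) * (univ : Finset (P k)).offDiag.card
      ≤ (∑ ab ∈ (univ : Finset (Fin 3)).offDiag,
          (((univ : Finset (Equiv.Perm (P k))).filter fun π =>
            π (Sum.inl ab.1) ∈ S3 π₀ ∧ π (Sum.inl ab.2) ∈ S3 π₀).card : ℝ)) *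
          (univ : Finset (P k)).offDiag.card := by
        refine mul_le_mul_of_nonneg_right ?_ (by positivity)
        exact_mod_cast (card_le_card hcover).trans card_biUnion_le
    _ = ∑ ab ∈ (univ : Finset (Fin 3)).offDiag, 6 * ((univ : Finset (Equiv.Perm (P k))).card : ℝ) := by
        rw [sum_mul]
        exact sum_congr rfl hpiece
    _ = 36 * (univ : Finset (Equiv.Perm (P k))).card := by
        rw [sum_const, offDiag_card]
        simp
        ring

/-! ### §3.4: the contribution of good pairs -/

/-- **Contribution of good pairs (Rothvoss 2017, §3.4, display (3)).** Summed over all encodings,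
`GOOD · p^ex_{U,T}(H) · p^ex_{M,T}(H)` is at most `(1+ε)³ · 36/(k²-k)` times `p_{U,T}(F) · p_{M,T}(F)`:
re-sample `H` inside `F` (`sum_resample`), bound good terms point-wise (`prod_le_of_Good`), use the
invariance of the `Q_k`-quantities (`pUk_resample`, `pMk_resample`) and Lemma 9 (`card_good_le`).
[cite: Rothvoss2017, §3.4] -/
theorem sum_good_le {𝓤 : Finset (Finset (Fin (rvN k m)))}
    {𝓜 : Finset ((⊤ : SimpleGraph (Fin (rvN k m))).Subgraph)} {ε : ℝ} (hk : Odd k) (hk3 : 3 < k)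
    (hε : 0 ≤ ε) (hR : ∀ U ∈ 𝓤, ∀ M ∈ 𝓜, crossing U M ≠ 1) :
    ∑ τ : Bij k m, (if Good k m 𝓤 𝓜 ε τ then pU k m 𝓤 τ * pM k m 𝓜 τ else 0) ≤
      (1 + ε) ^ 3 * (36 / ((k : ℝ) ^ 2 - k)) * ∑ τ : Bij k m, pUk k m 𝓤 τ * pMk k m 𝓜 τ := by
  set Np : ℝ := (Fintype.card (Equiv.Perm (P k)) : ℝ) with hNp
  have hNp_pos : 0 < Np := by
    rw [hNp]
    exact_mod_cast Fintype.card_pos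
  have hD : ((univ : Finset (P k)).offDiag.card : ℝ) = (k : ℝ) ^ 2 - k := by
    rw [offDiag_card, card_univ]
    have hc : Fintype.card (P k) = k := by
      simp [Fintype.card_sum]
      omega
    rw [hc]
    have : k ≤ k * k := Nat.le_mul_self k
    push_cast [Nat.cast_sub this]
    ring
  have hDpos : (0 : ℝ) < (k : ℝ) ^ 2 - k := by
    have : (3 : ℝ) < k := by exact_mod_cast hk3
    nlinarith
  -- re-sample: average the left-hand side over `π`
  have hres : ∀ π : Equiv.Perm (P k),
      ∑ τ : Bij k m, (if Good k m 𝓤 𝓜 ε τ then pU k m 𝓤 τ * pM k m 𝓜 τ else 0) =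
      ∑ τ : Bij k m, (if Good k m 𝓤 𝓜 ε ((alphaEquiv π).trans τ) then
        pU k m 𝓤 ((alphaEquiv π).trans τ) * pM k m 𝓜 ((alphaEquiv π).trans τ) else 0) :=
    fun π => (sum_resample (alphaEquiv π) _).symm
  have hlhs : ∑ τ : Bij k m, (if Good k m 𝓤 𝓜 ε τ then pU k m 𝓤 τ * pM k m 𝓜 τ else 0) =
      (∑ π : Equiv.Perm (P k), ∑ τ : Bij k m,
        (if Good k m 𝓤 𝓜 ε ((alphaEquiv π).trans τ) then
          pU k m 𝓤 ((alphaEquiv π).trans τ) * pM k m 𝓜 ((alphaEquiv π).trans τ) else 0)) / Np := by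
    rw [sum_congr rfl fun π _ => (hres π).symm, sum_const, card_univ, nsmul_eq_mul,
      mul_div_cancel_left₀ _ hNp_pos.ne']
  rw [hlhs, sum_comm, div_le_iff₀ hNp_pos]
  -- point-wise in `τ`
  have hτ : ∀ τ : Bij k m, ∑ π : Equiv.Perm (P k),
      (if Good k m 𝓤 𝓜 ε ((alphaEquiv π).trans τ) then
        pU k m 𝓤 ((alphaEquiv π).trans τ) * pM k m 𝓜 ((alphaEquiv π).trans τ) else 0) ≤
      (1 + ε) ^ 3 * (pUk k m 𝓤 τ * pMk k m 𝓜 τ) *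
        ((univ : Finset (Equiv.Perm (P k))).filter fun π =>
          Good k m 𝓤 𝓜 ε ((alphaEquiv π).trans τ)).card := by
    intro τ
    calc ∑ π : Equiv.Perm (P k), (if Good k m 𝓤 𝓜 ε ((alphaEquiv π).trans τ) then
            pU k m 𝓤 ((alphaEquiv π).trans τ) * pM k m 𝓜 ((alphaEquiv π).trans τ) else 0)
        ≤ ∑ π : Equiv.Perm (P k), (if Good k m 𝓤 𝓜 ε ((alphaEquiv π).trans τ) then
            (1 + ε) ^ 3 * (pUk k m 𝓤 τ * pMk k m 𝓜 τ) else 0) := by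
          refine sum_le_sum fun π _ => ?_
          split_ifs with h
          · rw [← pUk_resample 𝓤 π τ, ← pMk_resample 𝓜 π τ]
            exact prod_le_of_Good hk hε h
          · exact le_rfl
      _ = (1 + ε) ^ 3 * (pUk k m 𝓤 τ * pMk k m 𝓜 τ) *
          ((univ : Finset (Equiv.Perm (P k))).filter fun π =>
            Good k m 𝓤 𝓜 ε ((alphaEquiv π).trans τ)).card := by
          rw [← sum_filter, sum_const, nsmul_eq_mul, mul_comm]
  have hcnt : ∀ τ : Bij k m, ((((univ : Finset (Equiv.Perm (P k))).filter fun π =>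
      Good k m 𝓤 𝓜 ε ((alphaEquiv π).trans τ)).card : ℝ)) ≤ 36 / ((k : ℝ) ^ 2 - k) * Np := by
    intro τ
    have h := card_good_le hε hR τ (k := k) (m := m) (𝓤 := 𝓤) (𝓜 := 𝓜) (ε := ε)
    rw [hD, card_univ] at h
    rw [div_mul_eq_mul_div, le_div_iff₀ hDpos]
    linarith
  calc ∑ τ : Bij k m, ∑ π : Equiv.Perm (P k),
        (if Good k m 𝓤 𝓜 ε ((alphaEquiv π).trans τ) then
          pU k m 𝓤 ((alphaEquiv π).trans τ) * pM k m 𝓜 ((alphaEquiv π).trans τ) else 0)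
      ≤ ∑ τ : Bij k m, (1 + ε) ^ 3 * (pUk k m 𝓤 τ * pMk k m 𝓜 τ) * (36 / ((k : ℝ) ^ 2 - k) * Np) := by
        refine sum_le_sum fun τ _ => (hτ τ).trans ?_
        refine mul_le_mul_of_nonneg_left (hcnt τ) ?_
        have := pUk_nonneg (𝓤 := 𝓤) τ
        have := pMk_nonneg (𝓜 := 𝓜) τ
        positivity
    _ = (1 + ε) ^ 3 * (36 / ((k : ℝ) ^ 2 - k)) * (∑ τ : Bij k m, pUk k m 𝓤 τ * pMk k m 𝓜 τ) * Np := by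
        rw [mul_sum, sum_mul]
        exact sum_congr rfl fun τ _ => by ring

end Rothvoss

end Literature.Computability.Complexity

/-!
# Part II — Lemma 7 of Rothvoss 2017 and the proof of `rothvoss_matching_slack_bound`

Assembly of the quadratic measure increase (T. Rothvoss, *The matching polytope has exponential
extension complexity*, J. ACM 64 (2017) 41, Lemma 7) from its three parts, for the generated
measures `mu3`, `muk` of `RothvossMeasures.lean`:

`∑_τ pU pM = GOOD + (SMALL ∧ ¬GOOD) + BAD ≤ (1+ε)³·36/(k²-k) ∑_τ pUk pMk + |Bij| 2^{-δm} + η ∑_τ pU pM`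

with `η = 2ε_U + 3ε_M` (`sum_good_le` — Lemma 9 and §3.4, Part I above; `prod_le_of_Small`;
`ubad_part` — Lemma 14; `mbad_part` — Lemma 15), whence
`μ₃(𝓡) ≤ κ μ_k(𝓡) + 2^{-δ m}/(1-η)` with `κ = (1+ε)³·36/((k²-k)(1-η))` (`lemma7_of_parts`). The
entropy lemma (`few_biased_coordinates`, Lemma 10) supplies `δ_U`, `δ_M`; the density thresholds of
Lemmas 14/15 and the absorption of the constant `1/(1-η)` hold for all large `m` (`lemma7`). With
`k = 101`, `ε = 1/8`, `ε_U = 1/17`, `ε_M = 1/16` one has `κ (k-1) ≤ 1`, and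
`rothvoss_matching_slack_bound_of_corruption` (Lemma 7 ⇒ Lemma 6 ⇒ Theorem 1, `RothvossMeasures.lean`)
gives the named fact: **`Rothvoss.matching_slack_bound_holds : rothvoss_matching_slack_bound`**.

(The paper takes `k = 501`, `ε = 1/8` and the cruder constant `400/k²`; any odd `k` with
`κ (k-1) ≤ 1` works.) The named fact is ALSO discharged, independently, as
`rothvoss_matching_slack_bound_holds` in `MatchingExtensionComplexityHolds.lean`, which glues the
slot-model (`k = 75`) rectangle bound of `Literature/Barriers/PneNP/TSPExtensionComplexityRothvoss*`
to `rothvoss_matching_slack_bound_of_rectangle_bound`; the present file is the paper's own route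
(Lemmas 7–9, 14, 15 on the template of `RothvossTemplate.lean`), kept under a distinct name.

## References

* T. Rothvoss, *The matching polytope has exponential extension complexity*, J. ACM 64(6) (2017)
  41:1–41:19, Theorem 1, Lemma 7 and §3.3–§3.6 [Rothvoss2017].
-/

namespace Literature.Computability.Complexity

open Finset
open Literature.Probability.LatticeModels

namespace Rothvoss

open scoped Classical

variable {k m : ℕ}

/-! ### Lemma 7 from its parts, for one `m` -/

/-- **Lemma 7 of Rothvoss 2017 from its three parts** (display `(∗)` of §3.3 and "rearranging
terms"): given the bounds for good pairs (`sum_good_le`), small pairs, `U`-bad pairs (`≤ η_U μ₃`)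
and `M`-bad pairs (`≤ η_M μ₃`) with `η_U + η_M < 1`,
`μ₃(𝓡) ≤ c/(1-η) · μ_k(𝓡) + 2^{-δ m}/(1-η)`. [cite: Rothvoss2017, Lem. 7 & §3.3] -/
theorem lemma7_of_parts (hk3 : 3 ≤ k) {𝓤 : Finset (Finset (Fin (rvN k m)))}
    {𝓜 : Finset ((⊤ : SimpleGraph (Fin (rvN k m))).Subgraph)} {ε δ c ηU ηM : ℝ}
    (hgood : ∑ τ : Bij k m, (if Good k m 𝓤 𝓜 ε τ then pU k m 𝓤 τ * pM k m 𝓜 τ else 0) ≤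
      c * ∑ τ : Bij k m, pUk k m 𝓤 τ * pMk k m 𝓜 τ)
    (hubad : ∑ τ, (if UBad k m 𝓤 𝓜 ε δ τ then pU k m 𝓤 τ * pM k m 𝓜 τ else 0) ≤
      ηU * ∑ τ, pU k m 𝓤 τ * pM k m 𝓜 τ)
    (hmbad : ∑ τ, (if MBad k m 𝓤 𝓜 ε δ τ then pU k m 𝓤 τ * pM k m 𝓜 τ else 0) ≤
      ηM * ∑ τ, pU k m 𝓤 τ * pM k m 𝓜 τ)
    (hη : ηU + ηM < 1) :
    mu3 k m 𝓤 𝓜 ≤ c / (1 - (ηU + ηM)) * muk k m 𝓤 𝓜 + (2 : ℝ) ^ (-(δ * (m : ℝ))) / (1 - (ηU + ηM)) := by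
  have hN : (0 : ℝ) < Fintype.card (Bij k m) := by exact_mod_cast card_bij_pos hk3
  -- the three-way split of `∑ pU pM`
  have hsplit : ∑ τ : Bij k m, pU k m 𝓤 τ * pM k m 𝓜 τ =
      ∑ τ, (if Good k m 𝓤 𝓜 ε τ then pU k m 𝓤 τ * pM k m 𝓜 τ else 0) +
      ∑ τ, (if ¬ Good k m 𝓤 𝓜 ε τ ∧ Small k m 𝓤 𝓜 δ τ then pU k m 𝓤 τ * pM k m 𝓜 τ else 0) +
      ∑ τ, (if ¬ Good k m 𝓤 𝓜 ε τ ∧ ¬ Small k m 𝓤 𝓜 δ τ then pU k m 𝓤 τ * pM k m 𝓜 τ else 0) := by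
    rw [← sum_add_distrib, ← sum_add_distrib]
    refine sum_congr rfl fun τ _ => ?_
    by_cases hg : Good k m 𝓤 𝓜 ε τ <;> by_cases hs : Small k m 𝓤 𝓜 δ τ <;> simp [hg, hs]
  -- small pairs
  have hsmall : ∑ τ : Bij k m, (if ¬ Good k m 𝓤 𝓜 ε τ ∧ Small k m 𝓤 𝓜 δ τ then
      pU k m 𝓤 τ * pM k m 𝓜 τ else 0) ≤ Fintype.card (Bij k m) * (2 : ℝ) ^ (-(δ * (m : ℝ))) := by
    calc ∑ τ : Bij k m, (if ¬ Good k m 𝓤 𝓜 ε τ ∧ Small k m 𝓤 𝓜 δ τ then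
          pU k m 𝓤 τ * pM k m 𝓜 τ else 0) ≤ ∑ _τ : Bij k m, (2 : ℝ) ^ (-(δ * (m : ℝ))) := by
          refine sum_le_sum fun τ _ => ?_
          split_ifs with h
          · exact prod_le_of_Small h.2
          · positivity
      _ = Fintype.card (Bij k m) * (2 : ℝ) ^ (-(δ * (m : ℝ))) := by
          rw [sum_const, card_univ, nsmul_eq_mul]
  -- bad pairs
  have hbad : ∑ τ : Bij k m, (if ¬ Good k m 𝓤 𝓜 ε τ ∧ ¬ Small k m 𝓤 𝓜 δ τ then
      pU k m 𝓤 τ * pM k m 𝓜 τ else 0) ≤ (ηU + ηM) * ∑ τ, pU k m 𝓤 τ * pM k m 𝓜 τ := by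
    calc ∑ τ : Bij k m, (if ¬ Good k m 𝓤 𝓜 ε τ ∧ ¬ Small k m 𝓤 𝓜 δ τ then
          pU k m 𝓤 τ * pM k m 𝓜 τ else 0)
        ≤ ∑ τ, ((if UBad k m 𝓤 𝓜 ε δ τ then pU k m 𝓤 τ * pM k m 𝓜 τ else 0) +
            (if MBad k m 𝓤 𝓜 ε δ τ then pU k m 𝓤 τ * pM k m 𝓜 τ else 0)) := by
          refine sum_le_sum fun τ _ => ?_
          have h0 : 0 ≤ pU k m 𝓤 τ * pM k m 𝓜 τ := mul_nonneg (pU_mem τ).1 (pM_mem τ).1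
          by_cases h : ¬ Good k m 𝓤 𝓜 ε τ ∧ ¬ Small k m 𝓤 𝓜 δ τ
          · rw [if_pos h]
            rcases ubad_or_mbad h.2 h.1 with hu | hmb
            · rw [if_pos hu]
              have : 0 ≤ (if MBad k m 𝓤 𝓜 ε δ τ then pU k m 𝓤 τ * pM k m 𝓜 τ else 0) := by
                split_ifs <;> positivity
              linarith
            · rw [if_pos hmb]
              have : 0 ≤ (if UBad k m 𝓤 𝓜 ε δ τ then pU k m 𝓤 τ * pM k m 𝓜 τ else 0) := by
                split_ifs <;> positivity
              linarith
          · rw [if_neg h]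
            have h1 : 0 ≤ (if MBad k m 𝓤 𝓜 ε δ τ then pU k m 𝓤 τ * pM k m 𝓜 τ else 0) := by
              split_ifs <;> positivity
            have h2 : 0 ≤ (if UBad k m 𝓤 𝓜 ε δ τ then pU k m 𝓤 τ * pM k m 𝓜 τ else 0) := by
              split_ifs <;> positivity
            linarith
      _ ≤ (ηU + ηM) * ∑ τ, pU k m 𝓤 τ * pM k m 𝓜 τ := by
          rw [sum_add_distrib, add_mul]
          exact add_le_add hubad hmbad
  -- rearranging terms
  have h1η : 0 < 1 - (ηU + ηM) := by linarith
  have key : (1 - (ηU + ηM)) * ∑ τ : Bij k m, pU k m 𝓤 τ * pM k m 𝓜 τ ≤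
      c * ∑ τ : Bij k m, pUk k m 𝓤 τ * pMk k m 𝓜 τ +
        Fintype.card (Bij k m) * (2 : ℝ) ^ (-(δ * (m : ℝ))) := by
    linarith [hsplit, hsmall, hbad, hgood]
  unfold mu3 muk
  generalize ∑ τ : Bij k m, pU k m 𝓤 τ * pM k m 𝓜 τ = S at key ⊢
  generalize ∑ τ : Bij k m, pUk k m 𝓤 τ * pMk k m 𝓜 τ = Sk at key ⊢
  generalize (Fintype.card (Bij k m) : ℝ) = N at key hN ⊢
  have hNne : N ≠ 0 := hN.ne'
  have h1ηne : 1 - (ηU + ηM) ≠ 0 := h1η.ne'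
  rw [← sub_nonneg]
  have e : c / (1 - (ηU + ηM)) * (Sk / N) + (2 : ℝ) ^ (-(δ * (m : ℝ))) / (1 - (ηU + ηM)) - S / N =
      (c * Sk + N * (2 : ℝ) ^ (-(δ * (m : ℝ))) - (1 - (ηU + ηM)) * S) / ((1 - (ηU + ηM)) * N) := by
    field_simp
  rw [e]
  apply div_nonneg _ (mul_pos h1η hN).le
  linarith

/-! ### Growth estimates: everything is eventually true in `m` -/

/-- `c (m+1) ≤ 2^{a m}` for all large `m` (`a > 0`). [folklore] -/
theorem eventually_mul_le_two_rpow (c : ℝ) {a : ℝ} (ha : 0 < a) :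
    ∀ᶠ m : ℕ in Filter.atTop, c * ((m : ℝ) + 1) ≤ (2 : ℝ) ^ (a * (m : ℝ)) := by
  have hr1 : 1 < (2 : ℝ) ^ a := Real.one_lt_rpow (by norm_num) ha
  have hr0 : 0 < (2 : ℝ) ^ a := by positivity
  have ht := tendsto_pow_const_div_const_pow_of_one_lt 1 hr1
  have hθ : (0 : ℝ) < 1 / (2 * (|c| + 1)) := by positivity
  filter_upwards [(tendsto_order.1 ht).2 _ hθ, Filter.eventually_ge_atTop 1] with n hn hn1
  rw [pow_one, div_lt_iff₀ (pow_pos hr0 n)] at hn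
  have hrn : (2 : ℝ) ^ (a * (n : ℝ)) = ((2 : ℝ) ^ a) ^ n := Real.rpow_mul_natCast (by norm_num) a n
  have hn1' : (1 : ℝ) ≤ n := by exact_mod_cast hn1
  have h1 : c * ((n : ℝ) + 1) ≤ 2 * (|c| + 1) * n := by
    have hc := le_abs_self c
    have hca := abs_nonneg c
    nlinarith
  have h2 : 2 * (|c| + 1) * (n : ℝ) < ((2 : ℝ) ^ a) ^ n := by
    have hpos : (0 : ℝ) < 2 * (|c| + 1) := by positivity
    have hne : (2 * (|c| + 1) : ℝ) ≠ 0 := hpos.ne'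
    have h3 := mul_lt_mul_of_pos_left hn hpos
    have h4 : 2 * (|c| + 1) * (1 / (2 * (|c| + 1)) * ((2 : ℝ) ^ a) ^ n) = ((2 : ℝ) ^ a) ^ n := by
      field_simp
    linarith
  rw [hrn]
  linarith

/-- **The central binomial coefficient is at least average**: `2^m ≤ (m+1) binom(m, (m+1)/2)` for odd
`m`. [folklore] -/
theorem two_pow_le_succ_mul_choose (hm : Odd m) : 2 ^ m ≤ (m + 1) * m.choose ((m + 1) / 2) := by
  obtain ⟨r, rfl⟩ := hm
  have h1 : (2 * r + 1 + 1) / 2 = r + 1 := by omega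
  rw [h1, Nat.choose_symm_half]
  calc 2 ^ (2 * r + 1) = ∑ i ∈ range (2 * r + 1 + 1), (2 * r + 1).choose i :=
        (Nat.sum_range_choose _).symm
    _ ≤ ∑ _i ∈ range (2 * r + 1 + 1), (2 * r + 1).choose r := sum_le_sum fun i _ => by
        have h := Nat.choose_le_middle i (2 * r + 1)
        rwa [show (2 * r + 1) / 2 = r by omega] at h
    _ = (2 * r + 1 + 1) * (2 * r + 1).choose r := by rw [sum_const, card_range, smul_eq_mul]

/-- The density threshold of Lemma 14 (`|Y| ≥ 2^{-δ m} binom(m,(m+1)/2) ≥ 2^{-2δm}|X|` "for `m` large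
enough"), from the growth estimate `2(m+1) ≤ 2^{δ_U m/2}` and `δ ≤ δ_U/2`. [cite: Rothvoss2017, Lem. 14] -/
theorem densU_of (hm : Odd m) {δ δU : ℝ} (hδU : 0 ≤ δU) (hδ : δ ≤ δU / 2)
    (hgrow : 2 * ((m : ℝ) + 1) ≤ (2 : ℝ) ^ (δU / 2 * (m : ℝ))) :
    (2 : ℝ) ^ (-(δU * ((m : ℝ) + 1))) * 2 ^ (m + 1) ≤
      (2 : ℝ) ^ (-(δ * (m : ℝ))) * m.choose ((m + 1) / 2) := by
  have hC : (2 : ℝ) ^ m ≤ ((m : ℝ) + 1) * m.choose ((m + 1) / 2) := by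
    exact_mod_cast two_pow_le_succ_mul_choose hm
  have h2 : (0 : ℝ) < 2 := by norm_num
  have hm0 : (0 : ℝ) ≤ m := Nat.cast_nonneg m
  have hexp : (2 : ℝ) ^ (-(δU * ((m : ℝ) + 1))) * (2 : ℝ) ^ (δU / 2 * (m : ℝ)) ≤
      (2 : ℝ) ^ (-(δ * (m : ℝ))) := by
    rw [← Real.rpow_add h2]
    apply Real.rpow_le_rpow_of_exponent_le (by norm_num)
    nlinarith [mul_le_mul_of_nonneg_right hδ hm0]
  calc (2 : ℝ) ^ (-(δU * ((m : ℝ) + 1))) * 2 ^ (m + 1)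
      = (2 : ℝ) ^ (-(δU * ((m : ℝ) + 1))) * (2 * 2 ^ m) := by rw [pow_succ']
    _ ≤ (2 : ℝ) ^ (-(δU * ((m : ℝ) + 1))) * (2 * (((m : ℝ) + 1) * m.choose ((m + 1) / 2))) := by
        gcongr
    _ = (2 : ℝ) ^ (-(δU * ((m : ℝ) + 1))) * ((2 * ((m : ℝ) + 1)) * m.choose ((m + 1) / 2)) := by
        ring
    _ ≤ (2 : ℝ) ^ (-(δU * ((m : ℝ) + 1))) *
          ((2 : ℝ) ^ (δU / 2 * (m : ℝ)) * m.choose ((m + 1) / 2)) := by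
        gcongr
    _ = ((2 : ℝ) ^ (-(δU * ((m : ℝ) + 1))) * (2 : ℝ) ^ (δU / 2 * (m : ℝ))) *
          m.choose ((m + 1) / 2) := by ring
    _ ≤ (2 : ℝ) ^ (-(δ * (m : ℝ))) * m.choose ((m + 1) / 2) :=
        mul_le_mul_of_nonneg_right hexp (Nat.cast_nonneg _)

/-- The density threshold of Lemma 15 (`|Y| ≥ 2^{-δ m} ∏_{j ≠ i} |X_j| ≥ 2^{-2δ m} |X|` "for `m`
large enough"), from `|ext₀| ≤ q₀ |mats₀|`, the growth estimate `q₀ ≤ 2^{δ_M m}` and `δ ≤ δ_M`.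
[cite: Rothvoss2017, Lem. 15] -/
theorem densM_of (hk : Odd k) {δ δM : ℝ} (hδM : 0 ≤ δM) (hδ : δ ≤ δM)
    (hgrow : (Fintype.card (PMf (CoreV k)) : ℝ) ≤ (2 : ℝ) ^ (δM * (m : ℝ))) :
    (2 : ℝ) ^ (-(δM * (2 * (m : ℝ) + 1))) * (ext₀ k m).card ≤
      (2 : ℝ) ^ (-(δ * (m : ℝ))) * (mats₀ k m).card := by
  have h1 : ((ext₀ k m).card : ℝ) ≤ Fintype.card (PMf (CoreV k)) * (mats₀ k m).card := by
    exact_mod_cast card_ext₀_le hk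
  have h2 : (0 : ℝ) < 2 := by norm_num
  have hm0 : (0 : ℝ) ≤ m := Nat.cast_nonneg m
  have hexp : (2 : ℝ) ^ (-(δM * (2 * (m : ℝ) + 1))) * (2 : ℝ) ^ (δM * (m : ℝ)) ≤
      (2 : ℝ) ^ (-(δ * (m : ℝ))) := by
    rw [← Real.rpow_add h2]
    apply Real.rpow_le_rpow_of_exponent_le (by norm_num)
    nlinarith [mul_le_mul_of_nonneg_right hδ hm0]
  calc (2 : ℝ) ^ (-(δM * (2 * (m : ℝ) + 1))) * (ext₀ k m).card
      ≤ (2 : ℝ) ^ (-(δM * (2 * (m : ℝ) + 1))) * (Fintype.card (PMf (CoreV k)) * (mats₀ k m).card) := by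
        gcongr
    _ ≤ (2 : ℝ) ^ (-(δM * (2 * (m : ℝ) + 1))) * ((2 : ℝ) ^ (δM * (m : ℝ)) * (mats₀ k m).card) := by
        gcongr
    _ = ((2 : ℝ) ^ (-(δM * (2 * (m : ℝ) + 1))) * (2 : ℝ) ^ (δM * (m : ℝ))) * (mats₀ k m).card := by
        ring
    _ ≤ (2 : ℝ) ^ (-(δ * (m : ℝ))) * (mats₀ k m).card :=
        mul_le_mul_of_nonneg_right hexp (Nat.cast_nonneg _)

/-- Absorbing the constant: `2^{-δ m} C ≤ 2^{-(δ/2) m}` once `C ≤ 2^{(δ/2) m}`. [folklore] -/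
theorem rpow_mul_const_le {δ C : ℝ} (hC : C ≤ (2 : ℝ) ^ (δ / 2 * (m : ℝ))) :
    (2 : ℝ) ^ (-(δ * (m : ℝ))) * C ≤ (2 : ℝ) ^ (-(δ / 2 * (m : ℝ))) := by
  have h2 : (0 : ℝ) < 2 := by norm_num
  calc (2 : ℝ) ^ (-(δ * (m : ℝ))) * C ≤ (2 : ℝ) ^ (-(δ * (m : ℝ))) * (2 : ℝ) ^ (δ / 2 * (m : ℝ)) := by
        gcongr
    _ = (2 : ℝ) ^ (-(δ / 2 * (m : ℝ))) := by
        rw [← Real.rpow_add h2]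
        congr 1
        ring

/-! ### The blocks have boundedly many, and at least one, perfect matchings -/

/-- A bound `q` for the number of perfect matchings of any block (the paper's
`q = max{|X_i|}`, "some (huge) constant depending on `k`"). [cite: Rothvoss2017, Lem. 15] -/
noncomputable def qM (k : ℕ) : ℕ :=
  Fintype.card (PMf (CoreV k)) + Fintype.card (PMf (Fin (k - 3))) +
    Fintype.card (PMf (Fin (2 * (k - 3))))

/-- Every block has at most `qM k` perfect matchings. [cite: Rothvoss2017, Lem. 15] -/
theorem card_PMf_BV_le (b : BIdx m) : Fintype.card (PMf (BV k b)) ≤ qM k := by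
  rcases b with _ | ⟨i | i⟩
  · calc Fintype.card (PMf (BV k (none : BIdx m))) = Fintype.card (PMf (CoreV k)) :=
          Fintype.card_congr (Equiv.refl _)
      _ ≤ qM k := by unfold qM; omega
  · calc Fintype.card (PMf (BV k (some (.inl i) : BIdx m))) = Fintype.card (PMf (Fin (k - 3))) :=
          Fintype.card_congr (Equiv.refl _)
      _ ≤ qM k := by unfold qM; omega
  · calc Fintype.card (PMf (BV k (some (.inr i) : BIdx m))) = Fintype.card (PMf (Fin (2 * (k - 3)))) :=
          Fintype.card_congr (Equiv.refl _)
      _ ≤ qM k := by unfold qM; omega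

/-- Every block has a perfect matching (`k` odd). [folklore] -/
theorem card_PMf_BV_pos (hk : Odd k) (b : BIdx m) : 0 < Fintype.card (PMf (BV k b)) := by
  obtain ⟨f₀, hf₀⟩ := mats₀_nonempty (m := m) hk
  have hf₀e := mats₀_subset_ext₀ hf₀
  rcases b with _ | ⟨i | i⟩
  · exact Fintype.card_pos_iff.2 ⟨⟨coreMap f₀, coreMap_spec_ext₀ hf₀e⟩⟩
  · exact Fintype.card_pos_iff.2 ⟨⟨aMap f₀ i, aMap_spec_ext₀ hf₀e i⟩⟩
  · exact Fintype.card_pos_iff.2 ⟨⟨bMap f₀ i, bMap_spec_ext₀ hf₀e i⟩⟩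

/-! ### Lemma 7, eventually in `m` -/

/-- **Lemma 7 of Rothvoss 2017 (the quadratic measure increase), PROVED** for the generated
measures: for odd `k > 3`, `0 ≤ ε`, `0 < ε_U` with `(1+ε_U)² ≤ 1+ε`, `0 < ε_M ≤ ε` and
`η = 2ε_U + 3ε_M < 1`, there is `δ > 0` such that for all large odd `m` and every rectangle
`𝓤 × 𝓜` without an entry `|M ∩ δ(U)| = 1`,
`μ₃(𝓡) ≤ (1+ε)³·36/((k²-k)(1-η)) · μ_k(𝓡) + 2^{-δ m}`.
(The paper: `μ₃(𝓡) ≤ 400/k² · μ_k(𝓡) + 2^{-δ m}`.) [cite: Rothvoss2017, Lem. 7] -/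
theorem lemma7 (hk : Odd k) (hk3 : 3 < k) {ε εU εM : ℝ} (hε : 0 ≤ ε) (hεU : 0 < εU)
    (hεU2 : (1 + εU) ^ 2 ≤ 1 + ε) (hεM : 0 < εM) (hεMε : εM ≤ ε) (hη : 2 * εU + 3 * εM < 1) :
    ∃ δ : ℝ, 0 < δ ∧ ∀ᶠ m : ℕ in Filter.atTop, Odd m →
      ∀ (𝓤 : Finset (Finset (Fin (rvN k m)))) (𝓜 : Finset ((⊤ : SimpleGraph (Fin (rvN k m))).Subgraph)),
      (∀ U ∈ 𝓤, ∀ M ∈ 𝓜, crossing U M ≠ 1) →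
        mu3 k m 𝓤 𝓜 ≤ (1 + ε) ^ 3 * (36 / ((k : ℝ) ^ 2 - k)) / (1 - (2 * εU + 3 * εM)) * muk k m 𝓤 𝓜 +
          (2 : ℝ) ^ (-(δ * (m : ℝ))) := by
  -- the entropy lemma, once for `0/1`-vectors and once for the block product
  obtain ⟨δU, hδU, HU⟩ := Literature.InformationTheory.Entropy.few_biased_coordinates.{0, 0} hεU 2
  obtain ⟨δM, hδM, HM⟩ := Literature.InformationTheory.Entropy.few_biased_coordinates.{0, 0} hεM (qM k)
  set δ₀ : ℝ := min (δU / 2) δM with hδ₀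
  have hδ₀pos : 0 < δ₀ := lt_min (by linarith) hδM
  have hδ₀U : δ₀ ≤ δU / 2 := min_le_left _ _
  have hδ₀M : δ₀ ≤ δM := min_le_right _ _
  have h1η : 0 < 1 - (2 * εU + 3 * εM) := by linarith
  refine ⟨δ₀ / 2, by linarith, ?_⟩
  filter_upwards [eventually_mul_le_two_rpow 2 (by linarith : 0 < δU / 2),
    eventually_mul_le_two_rpow (Fintype.card (PMf (CoreV k)) : ℝ) hδM,
    eventually_mul_le_two_rpow (1 / (1 - (2 * εU + 3 * εM))) (by linarith : 0 < δ₀ / 2)]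
    with m hmU hmM hmC hmo 𝓤 𝓜 hR
  have hm1 : 0 < m := hmo.pos
  have hm1' : (1 : ℝ) ≤ (m : ℝ) + 1 := by linarith [(Nat.cast_nonneg m : (0 : ℝ) ≤ m)]
  -- Lemma 10 for `0/1`-vectors on `m+1` coordinates
  have hL10U : ∀ Y : Finset (Option (Fin m) → Bool),
      (2 : ℝ) ^ (-(δU * ((m : ℝ) + 1))) * 2 ^ (m + 1) ≤ Y.card →
      ∃ B : Finset (Option (Fin m)), (B.card : ℝ) ≤ εU * ((m : ℝ) + 1) ∧ ∀ i ∉ B, ∀ b : Bool,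
        (Y.card : ℝ) / ((1 + εU) * 2) ≤ (Y.filter fun y => y i = b).card ∧
        ((Y.filter fun y => y i = b).card : ℝ) ≤ (1 + εU) * Y.card / 2 := by
    intro Y hY
    have hc : (Fintype.card (Option (Fin m)) : ℝ) = (m : ℝ) + 1 := by simp
    have h := @HU (Option (Fin m)) _ _ (fun _ => Bool) _ _ (fun _ => by simp) (fun _ => by simp) Y
      (by
        rw [hc]
        simpa [Finset.prod_const, Finset.card_univ] using hY)
    rw [hc] at h
    simpa using h
  -- Lemma 10 for the block product
  have hL10M : ∀ Y : Finset ((b : BIdx m) → PMf (BV k b)),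
      (2 : ℝ) ^ (-(δM * (2 * (m : ℝ) + 1))) * Fintype.card ((b : BIdx m) → PMf (BV k b)) ≤ Y.card →
      ∃ B : Finset (BIdx m), (B.card : ℝ) ≤ εM * (2 * (m : ℝ) + 1) ∧ ∀ b ∉ B, ∀ x : PMf (BV k b),
        (Y.card : ℝ) / ((1 + εM) * Fintype.card (PMf (BV k b))) ≤ (Y.filter fun y => y b = x).card ∧
        ((Y.filter fun y => y b = x).card : ℝ) ≤ (1 + εM) * Y.card / Fintype.card (PMf (BV k b)) := by
    intro Y hY
    have hc : (Fintype.card (BIdx m) : ℝ) = 2 * (m : ℝ) + 1 := by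
      rw [card_BIdx]
      push_cast
      ring
    have hprod : ∏ b : BIdx m, (Fintype.card (PMf (BV k b)) : ℝ) =
        Fintype.card ((b : BIdx m) → PMf (BV k b)) := by
      rw [Fintype.card_pi, Nat.cast_prod]
    have h := @HM (BIdx m) _ _ (fun b => PMf (BV k b)) _ _ (fun b => card_PMf_BV_le b)
      (fun b => card_PMf_BV_pos hk b) Y (by
        rw [hc, hprod]
        exact hY)
    beta_reduce at h
    rw [hc] at h
    exact h
  -- the parts
  have hgood := sum_good_le (𝓤 := 𝓤) (𝓜 := 𝓜) hk hk3 hε hR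
  have hubad := ubad_part hk3 hmo hεU.le hεU2 hL10U
    (densU_of hmo hδU.le (by linarith : δ₀ ≤ δU / 2) hmU) 𝓤 𝓜
  have hmbad := mbad_part hk hm1 hεM.le hεMε hL10M
    (densM_of hk hδM.le hδ₀M ((le_mul_of_one_le_right (Nat.cast_nonneg _) hm1').trans hmM)) 𝓤 𝓜
  have h7 := lemma7_of_parts (by omega) hgood hubad hmbad hη
  -- absorb `1/(1-η)` into the exponent
  have habs : (2 : ℝ) ^ (-(δ₀ * (m : ℝ))) / (1 - (2 * εU + 3 * εM)) ≤ (2 : ℝ) ^ (-(δ₀ / 2 * (m : ℝ))) := by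
    rw [div_eq_mul_one_div]
    exact rpow_mul_const_le ((le_mul_of_one_le_right (one_div_pos.2 h1η).le hm1').trans hmC)
  linarith

/-! ### Theorem 1 of Rothvoss 2017 (slack-matrix form): the named fact holds -/

/-- **Rothvoss 2017, Theorem 1 (slack-matrix form), PROVED along the paper's route**: for some
`c > 0` and all large even `n`, the odd-cut part of the slack matrix of the perfect matching
polytope of `K_n` has no nonnegative factorisation of rank `≤ 2^{c n}`. Assembled from Lemma 5
(hyperplane separation, `RectangleCorruptionBound.lean`), the reduction "(2) + Lemma 6 ⇒ Theorem 1"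
(`MatchingExtensionComplexityProofs.lean`), "Lemma 7 ⇒ Lemma 6" (`RothvossMeasures.lean`) and
Lemma 7 (`Rothvoss.lemma7`, with `k = 101`, `ε = 1/8`, `ε_U = 1/17`, `ε_M = 1/16`). (A second,
independent discharge of the same named fact is `rothvoss_matching_slack_bound_holds` in
`MatchingExtensionComplexityHolds.lean`.) [cite: Rothvoss2017, Thm. 1] -/
theorem matching_slack_bound_holds : rothvoss_matching_slack_bound := by
  have hk : Odd 101 := ⟨50, by norm_num⟩
  have hk3 : 3 < 101 := by norm_num
  obtain ⟨δ, hδ, h7⟩ := lemma7 (ε := 1 / 8) (εU := 1 / 17) (εM := 1 / 16) hk hk3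
    (by norm_num) (by norm_num) (by norm_num) (by norm_num) (by norm_num) (by norm_num)
  refine rothvoss_matching_slack_bound_of_corruption hk hk3 ?_ hδ
    (h7.mono fun m hm hmo 𝓤 𝓜 _ _ hR => hm hmo 𝓤 𝓜 hR)
  norm_num

end Rothvoss

end Literature.Computability.Complexity
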